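import Summits.Ventures.PercRepro.S1CoreCapChain
import Summits.Ventures.PercRepro.S1FiveCircuitBase
import Summits.Ventures.PercRepro.RankLevelSetFiveCircuitAvg
import Summits.Ventures.PercRepro.RankLevelSetFrameQ
import Summits.Ventures.PercRepro.MatroidMidCount

/-!
# PercRepro — THE COLOOP-FREE AVERAGING STEP AND THE COLOOP SPLIT AT LEVEL `6` (p8 g7, S3)

`proofs/SUBCLAIM-S3-p8.md` §3t. Two devices for the `27` row. (i) ON A CORE WITH NO COLOOP THE AVERAGING STEP RUNS WITH
`m = |E|`: p2's `S1.ncard_fourCircuits_sub_div_le_of_nonColoops` takes the number of non-coloops as a hypothesis; when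
`M` has no coloop that number is `|E| = p + d`, and the step from p2's nullity-only chains `avgChain` / `avgChain5b` at
nullity `d − 1` gives `s₄ ≤ 60 / 89 / 128 / 178 / 241 / 320 / 417 / 535` and `s₅ ≤ 274 / 467 / 756 / 1170 / 1748 / 2532 /
3574 / 4932` at nullity `d = 7 … 14` on `≥ 27 + d` points (`s4_cf_d`, `s5_cf_d`; the 5-circuit step with an explicit
non-coloop count is `ncard_fiveCircuits_sub_div_le_of_nonColoops`, RankLevelSetFiveCircuitAvg's recursion with `m` in
place of `d + 6`). (ii) THE COLOOP SPLIT: for a coloop `e` of `M` with `r(M) = p + 1`, `#U_M(p+1, q+1) = #U_{M∖e}(p, q+1)`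
(typer-2's `Matroid.topCount_eq_of_isColoop_of_eRank`) and `#Y_M(p+1, q+1) = 2·#Y_{M∖e}(p, q+1) + …` (night-1's
`Matroid.midCount_eq_of_isColoop_q`), so `RLS M (p+1) (q+1)` follows from the SCALED inequality
`(Φ(p+1, q+1)/2)·#U_{M∖e}(p, q+1) ≤ #Y_{M∖e}(p, q+1)` (`RLS_of_coloop_scaled`); the scaled inequality is the cell
theorem with a general denominator (`level_arith_KD`: `Φ ≤ 2^{p+q}/D` in place of `Φ ≤ 2^{p+q}/C(p+q, q)`;
RankLevelSetLevelSixHeavyCellSq27D). Axioms: standard.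
-/

open scoped Matroid

namespace PercRepro

namespace ThmN

open Set

variable {α : Type}

open Classical in
/-- **The 5-circuit averaging step with an explicit non-coloop count**: on a core of nullity `d + 1` with at least `m`
non-coloops, if every core of nullity `d` has `s₅ ≤ B`, then `s₅ − ⌊5·s₅/m⌋ ≤ B` (RankLevelSetFiveCircuitAvg's
`ncard_fiveCircuits_sub_div_le` with `m` in place of `d + 6`). -/
theorem ncard_fiveCircuits_sub_div_le_of_nonColoops (M : Matroid α) [M.Finite]
    (hfree : ∀ e ∈ M.E, ∃ A ⊆ M.E \ {e}, e ∉ M.closure A ∧ e ∉ M.closure ((M.E \ {e}) \ A))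
    {d : ℕ} (hd : M.E.encard = M.eRank + (d + 1)) {m : ℕ} (hm0 : 0 < m)
    (hm : m ≤ (M.E \ M.coloops).ncard) {B : ℕ}
    (hB : ∀ (M' : Matroid α) [M'.Finite],
      (∀ e ∈ M'.E, ∃ A ⊆ M'.E \ {e}, e ∉ M'.closure A ∧ e ∉ M'.closure ((M'.E \ {e}) \ A)) →
      M'.E.encard = M'.eRank + d → {C : Set α | M'.IsCircuit C ∧ C.ncard = 5}.ncard ≤ B) :
    {C : Set α | M.IsCircuit C ∧ C.ncard = 5}.ncard -
      5 * {C : Set α | M.IsCircuit C ∧ C.ncard = 5}.ncard / m ≤ B := by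
  rcases Nat.eq_zero_or_pos {C : Set α | M.IsCircuit C ∧ C.ncard = 5}.ncard with h0 | hpos
  · rw [h0]; simp
  obtain ⟨x, hxE, hxc, hx⟩ := exists_nonColoop_ncard_fiveCircuitsThrough_le M hpos
  -- the non-coloops number at least `m`
  have hm' : m ≤ (M.ground_finite.toFinset.filter (fun x => ¬ M.IsColoop x)).card := by
    have : (M.ground_finite.toFinset.filter (fun x => ¬ M.IsColoop x) : Set α) = M.E \ M.coloops := by
      ext y; simp only [Finset.coe_filter, Set.Finite.mem_toFinset, mem_setOf_eq, mem_sdiff,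
        Matroid.isColoop_iff_mem_coloops]
    rw [← ncard_coe_finset, this]
    exact hm
  have hx' : {C : Set α | M.IsCircuit C ∧ C.ncard = 5 ∧ x ∈ C}.ncard ≤
      5 * {C : Set α | M.IsCircuit C ∧ C.ncard = 5}.ncard / m :=
    hx.trans (Nat.div_le_div_left hm' hm0)
  -- `M ＼ {x}` is a core of nullity `d`
  have hν : M✶.eRank = ((d + 1 : ℕ) : ℕ∞) := by
    have h := _root_.Matroid.eRank_add_eRank_dual M
    rw [hd] at h
    exact WithTop.add_left_cancel (PercRepro.Matroid.eRank_ne_top_of_finite M) h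
  have hdel := PercRepro.Matroid.dual_eRank_delete_singleton_add_one hxE hxc
  rw [hν] at hdel
  have hfin' : (M ＼ {x})✶.eRank ≠ ⊤ := by
    intro h
    rw [h] at hdel
    have h2 : ((d + 1 : ℕ) : ℕ∞) = ⊤ := by rw [← hdel]; simp
    exact ENat.coe_ne_top _ h2
  obtain ⟨d', hd'⟩ := ENat.ne_top_iff_exists.1 hfin'
  have hdd' : d = d' := by
    rw [← hd'] at hdel
    have : d' + 1 = d + 1 := by exact_mod_cast hdel
    omega
  subst hdd'
  have hd'enc : (M ＼ {x}).E.encard = (M ＼ {x}).eRank + d := by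
    have h := _root_.Matroid.eRank_add_eRank_dual (M ＼ {x})
    rw [← hd'] at h
    exact h.symm
  have hB' := hB (M ＼ {x}) (S1.hfree_delete M hfree x) hd'enc
  have hsplit := ncard_fiveCircuits_le_through_add_delete M x
  omega

/-- A matroid with no coloop among its points has `M.coloops = ∅`. -/
theorem coloops_eq_empty_of_forall (M : Matroid α) (hcf : ∀ e ∈ M.E, ¬ M.IsColoop e) : M.coloops = ∅ :=
  Set.eq_empty_iff_forall_notMem.2 fun e he =>
    hcf e (M.coloops_subset_ground he) (Matroid.isColoop_iff_mem_coloops.2 he)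

/-- With no coloop, every point is a non-coloop: `|E ∖ coloops| = |E|`. -/
theorem ncard_nonColoops_eq_of_forall (M : Matroid α) (hcf : ∀ e ∈ M.E, ¬ M.IsColoop e) :
    (M.E \ M.coloops).ncard = M.E.ncard := by
  rw [coloops_eq_empty_of_forall M hcf, Set.sdiff_empty]

/-- **The coloop-free 4-circuit step on p2's chain**: on a core of nullity `d + 1` with no coloop and `≥ m ≥ 1` points,
`s₄ − ⌊4·s₄/m⌋ ≤ avgChain d` (S1CoreCapChain). -/
theorem ncard_fourCircuits_sub_div_le_avgChain_of_coloopFree (M : Matroid α) [M.Finite]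
    (hfree : ∀ e ∈ M.E, ∃ A ⊆ M.E \ {e}, e ∉ M.closure A ∧ e ∉ M.closure ((M.E \ {e}) \ A))
    (hcf : ∀ e ∈ M.E, ¬ M.IsColoop e) {d : ℕ} (hd : M.E.encard = M.eRank + (d + 1)) {m : ℕ} (hm0 : 0 < m)
    (hm : m ≤ M.E.ncard) :
    {C : Set α | M.IsCircuit C ∧ C.ncard = 4}.ncard -
      4 * {C : Set α | M.IsCircuit C ∧ C.ncard = 4}.ncard / m ≤ S1.avgChain d :=
  S1.ncard_fourCircuits_sub_div_le_of_nonColoops M hfree hd hm0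
    (by rw [ncard_nonColoops_eq_of_forall M hcf]; exact hm)
    (fun M' _ hfree' hd' => S1.ncard_fourCircuits_le_avgChain d M' hfree' hd')

/-- **The coloop-free 5-circuit step on p2's chain**: on a core of nullity `d + 1` with no coloop and `≥ m ≥ 1` points,
`s₅ − ⌊5·s₅/m⌋ ≤ avgChain5b d` (S1FiveCircuitBase). -/
theorem ncard_fiveCircuits_sub_div_le_avgChain5b_of_coloopFree (M : Matroid α) [M.Finite]
    (hfree : ∀ e ∈ M.E, ∃ A ⊆ M.E \ {e}, e ∉ M.closure A ∧ e ∉ M.closure ((M.E \ {e}) \ A))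
    (hcf : ∀ e ∈ M.E, ¬ M.IsColoop e) {d : ℕ} (hd : M.E.encard = M.eRank + (d + 1)) {m : ℕ} (hm0 : 0 < m)
    (hm : m ≤ M.E.ncard) :
    {C : Set α | M.IsCircuit C ∧ C.ncard = 5}.ncard -
      5 * {C : Set α | M.IsCircuit C ∧ C.ncard = 5}.ncard / m ≤ S1.avgChain5b d :=
  ncard_fiveCircuits_sub_div_le_of_nonColoops M hfree hd hm0
    (by rw [ncard_nonColoops_eq_of_forall M hcf]; exact hm)
    (fun M' _ hfree' hd' => S1.ncard_fiveCircuits_le_avgChain5b d M' hfree' hd')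

/-- The chain values used below: `avgChain 6 … 13 = 53, 79, 114, 159, 216, 288, 376, 483`. -/
theorem avgChain_values_cf : S1.avgChain 6 = 53 ∧ S1.avgChain 7 = 79 ∧ S1.avgChain 8 = 114 ∧ S1.avgChain 9 = 159 ∧
    S1.avgChain 10 = 216 ∧ S1.avgChain 11 = 288 ∧ S1.avgChain 12 = 376 ∧ S1.avgChain 13 = 483 := by decide

/-- The chain values used below: `avgChain5b 6 … 13 = 234, 401, 651, 1012, 1518, 2208, 3128, 4331`. -/
theorem avgChain5b_values_cf : S1.avgChain5b 6 = 234 ∧ S1.avgChain5b 7 = 401 ∧ S1.avgChain5b 8 = 651 ∧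
    S1.avgChain5b 9 = 1012 ∧ S1.avgChain5b 10 = 1518 ∧ S1.avgChain5b 11 = 2208 ∧ S1.avgChain5b 12 = 3128 ∧
    S1.avgChain5b 13 = 4331 := by decide

/-- **`s₄ ≤ 60` on a coloop-free core of nullity `7` with `≥ 34` points** (`s − ⌊4s/34⌋ ≤ 53`). -/
theorem s4_cf_7 (M : Matroid α) [M.Finite]
    (hfree : ∀ e ∈ M.E, ∃ A ⊆ M.E \ {e}, e ∉ M.closure A ∧ e ∉ M.closure ((M.E \ {e}) \ A))
    (hcf : ∀ e ∈ M.E, ¬ M.IsColoop e) (hd : M.E.encard = M.eRank + 7) (hn : 34 ≤ M.E.ncard) :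
    {C : Set α | M.IsCircuit C ∧ C.ncard = 4}.ncard ≤ 60 := by
  have h := ncard_fourCircuits_sub_div_le_avgChain_of_coloopFree M hfree hcf (d := 6) (m := 34)
    (by rw [hd]; norm_num) (by norm_num) hn
  rw [avgChain_values_cf.1] at h
  omega

/-- **`s₄ ≤ 89` on a coloop-free core of nullity `8` with `≥ 35` points** (`s − ⌊4s/35⌋ ≤ 79`). -/
theorem s4_cf_8 (M : Matroid α) [M.Finite]
    (hfree : ∀ e ∈ M.E, ∃ A ⊆ M.E \ {e}, e ∉ M.closure A ∧ e ∉ M.closure ((M.E \ {e}) \ A))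
    (hcf : ∀ e ∈ M.E, ¬ M.IsColoop e) (hd : M.E.encard = M.eRank + 8) (hn : 35 ≤ M.E.ncard) :
    {C : Set α | M.IsCircuit C ∧ C.ncard = 4}.ncard ≤ 89 := by
  have h := ncard_fourCircuits_sub_div_le_avgChain_of_coloopFree M hfree hcf (d := 7) (m := 35)
    (by rw [hd]; norm_num) (by norm_num) hn
  rw [avgChain_values_cf.2.1] at h
  omega

/-- **`s₄ ≤ 128` on a coloop-free core of nullity `9` with `≥ 36` points** (`s − ⌊4s/36⌋ ≤ 114`). -/
theorem s4_cf_9 (M : Matroid α) [M.Finite]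
    (hfree : ∀ e ∈ M.E, ∃ A ⊆ M.E \ {e}, e ∉ M.closure A ∧ e ∉ M.closure ((M.E \ {e}) \ A))
    (hcf : ∀ e ∈ M.E, ¬ M.IsColoop e) (hd : M.E.encard = M.eRank + 9) (hn : 36 ≤ M.E.ncard) :
    {C : Set α | M.IsCircuit C ∧ C.ncard = 4}.ncard ≤ 128 := by
  have h := ncard_fourCircuits_sub_div_le_avgChain_of_coloopFree M hfree hcf (d := 8) (m := 36)
    (by rw [hd]; norm_num) (by norm_num) hn
  rw [avgChain_values_cf.2.2.1] at h
  omega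

/-- **`s₄ ≤ 178` on a coloop-free core of nullity `10` with `≥ 37` points** (`s − ⌊4s/37⌋ ≤ 159`). -/
theorem s4_cf_10 (M : Matroid α) [M.Finite]
    (hfree : ∀ e ∈ M.E, ∃ A ⊆ M.E \ {e}, e ∉ M.closure A ∧ e ∉ M.closure ((M.E \ {e}) \ A))
    (hcf : ∀ e ∈ M.E, ¬ M.IsColoop e) (hd : M.E.encard = M.eRank + 10) (hn : 37 ≤ M.E.ncard) :
    {C : Set α | M.IsCircuit C ∧ C.ncard = 4}.ncard ≤ 178 := by
  have h := ncard_fourCircuits_sub_div_le_avgChain_of_coloopFree M hfree hcf (d := 9) (m := 37)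
    (by rw [hd]; norm_num) (by norm_num) hn
  rw [avgChain_values_cf.2.2.2.1] at h
  omega

/-- **`s₄ ≤ 241` on a coloop-free core of nullity `11` with `≥ 38` points** (`s − ⌊4s/38⌋ ≤ 216`). -/
theorem s4_cf_11 (M : Matroid α) [M.Finite]
    (hfree : ∀ e ∈ M.E, ∃ A ⊆ M.E \ {e}, e ∉ M.closure A ∧ e ∉ M.closure ((M.E \ {e}) \ A))
    (hcf : ∀ e ∈ M.E, ¬ M.IsColoop e) (hd : M.E.encard = M.eRank + 11) (hn : 38 ≤ M.E.ncard) :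
    {C : Set α | M.IsCircuit C ∧ C.ncard = 4}.ncard ≤ 241 := by
  have h := ncard_fourCircuits_sub_div_le_avgChain_of_coloopFree M hfree hcf (d := 10) (m := 38)
    (by rw [hd]; norm_num) (by norm_num) hn
  rw [avgChain_values_cf.2.2.2.2.1] at h
  omega

/-- **`s₄ ≤ 320` on a coloop-free core of nullity `12` with `≥ 39` points** (`s − ⌊4s/39⌋ ≤ 288`). -/
theorem s4_cf_12 (M : Matroid α) [M.Finite]
    (hfree : ∀ e ∈ M.E, ∃ A ⊆ M.E \ {e}, e ∉ M.closure A ∧ e ∉ M.closure ((M.E \ {e}) \ A))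
    (hcf : ∀ e ∈ M.E, ¬ M.IsColoop e) (hd : M.E.encard = M.eRank + 12) (hn : 39 ≤ M.E.ncard) :
    {C : Set α | M.IsCircuit C ∧ C.ncard = 4}.ncard ≤ 320 := by
  have h := ncard_fourCircuits_sub_div_le_avgChain_of_coloopFree M hfree hcf (d := 11) (m := 39)
    (by rw [hd]; norm_num) (by norm_num) hn
  rw [avgChain_values_cf.2.2.2.2.2.1] at h
  omega

/-- **`s₄ ≤ 417` on a coloop-free core of nullity `13` with `≥ 40` points** (`s − ⌊4s/40⌋ ≤ 376`). -/
theorem s4_cf_13 (M : Matroid α) [M.Finite]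
    (hfree : ∀ e ∈ M.E, ∃ A ⊆ M.E \ {e}, e ∉ M.closure A ∧ e ∉ M.closure ((M.E \ {e}) \ A))
    (hcf : ∀ e ∈ M.E, ¬ M.IsColoop e) (hd : M.E.encard = M.eRank + 13) (hn : 40 ≤ M.E.ncard) :
    {C : Set α | M.IsCircuit C ∧ C.ncard = 4}.ncard ≤ 417 := by
  have h := ncard_fourCircuits_sub_div_le_avgChain_of_coloopFree M hfree hcf (d := 12) (m := 40)
    (by rw [hd]; norm_num) (by norm_num) hn
  rw [avgChain_values_cf.2.2.2.2.2.2.1] at h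
  omega

/-- **`s₄ ≤ 535` on a coloop-free core of nullity `14` with `≥ 41` points** (`s − ⌊4s/41⌋ ≤ 483`). -/
theorem s4_cf_14 (M : Matroid α) [M.Finite]
    (hfree : ∀ e ∈ M.E, ∃ A ⊆ M.E \ {e}, e ∉ M.closure A ∧ e ∉ M.closure ((M.E \ {e}) \ A))
    (hcf : ∀ e ∈ M.E, ¬ M.IsColoop e) (hd : M.E.encard = M.eRank + 14) (hn : 41 ≤ M.E.ncard) :
    {C : Set α | M.IsCircuit C ∧ C.ncard = 4}.ncard ≤ 535 := by
  have h := ncard_fourCircuits_sub_div_le_avgChain_of_coloopFree M hfree hcf (d := 13) (m := 41)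
    (by rw [hd]; norm_num) (by norm_num) hn
  rw [avgChain_values_cf.2.2.2.2.2.2.2] at h
  omega

/-- **`s₅ ≤ 274` on a coloop-free core of nullity `7` with `≥ 34` points** (`s − ⌊5s/34⌋ ≤ 234`). -/
theorem s5_cf_7 (M : Matroid α) [M.Finite]
    (hfree : ∀ e ∈ M.E, ∃ A ⊆ M.E \ {e}, e ∉ M.closure A ∧ e ∉ M.closure ((M.E \ {e}) \ A))
    (hcf : ∀ e ∈ M.E, ¬ M.IsColoop e) (hd : M.E.encard = M.eRank + 7) (hn : 34 ≤ M.E.ncard) :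
    {C : Set α | M.IsCircuit C ∧ C.ncard = 5}.ncard ≤ 274 := by
  have h := ncard_fiveCircuits_sub_div_le_avgChain5b_of_coloopFree M hfree hcf (d := 6) (m := 34)
    (by rw [hd]; norm_num) (by norm_num) hn
  rw [avgChain5b_values_cf.1] at h
  omega

/-- **`s₅ ≤ 467` on a coloop-free core of nullity `8` with `≥ 35` points** (`s − ⌊5s/35⌋ ≤ 401`). -/
theorem s5_cf_8 (M : Matroid α) [M.Finite]
    (hfree : ∀ e ∈ M.E, ∃ A ⊆ M.E \ {e}, e ∉ M.closure A ∧ e ∉ M.closure ((M.E \ {e}) \ A))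
    (hcf : ∀ e ∈ M.E, ¬ M.IsColoop e) (hd : M.E.encard = M.eRank + 8) (hn : 35 ≤ M.E.ncard) :
    {C : Set α | M.IsCircuit C ∧ C.ncard = 5}.ncard ≤ 467 := by
  have h := ncard_fiveCircuits_sub_div_le_avgChain5b_of_coloopFree M hfree hcf (d := 7) (m := 35)
    (by rw [hd]; norm_num) (by norm_num) hn
  rw [avgChain5b_values_cf.2.1] at h
  omega

/-- **`s₅ ≤ 756` on a coloop-free core of nullity `9` with `≥ 36` points** (`s − ⌊5s/36⌋ ≤ 651`). -/
theorem s5_cf_9 (M : Matroid α) [M.Finite]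
    (hfree : ∀ e ∈ M.E, ∃ A ⊆ M.E \ {e}, e ∉ M.closure A ∧ e ∉ M.closure ((M.E \ {e}) \ A))
    (hcf : ∀ e ∈ M.E, ¬ M.IsColoop e) (hd : M.E.encard = M.eRank + 9) (hn : 36 ≤ M.E.ncard) :
    {C : Set α | M.IsCircuit C ∧ C.ncard = 5}.ncard ≤ 756 := by
  have h := ncard_fiveCircuits_sub_div_le_avgChain5b_of_coloopFree M hfree hcf (d := 8) (m := 36)
    (by rw [hd]; norm_num) (by norm_num) hn
  rw [avgChain5b_values_cf.2.2.1] at h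
  omega

/-- **`s₅ ≤ 1170` on a coloop-free core of nullity `10` with `≥ 37` points** (`s − ⌊5s/37⌋ ≤ 1012`). -/
theorem s5_cf_10 (M : Matroid α) [M.Finite]
    (hfree : ∀ e ∈ M.E, ∃ A ⊆ M.E \ {e}, e ∉ M.closure A ∧ e ∉ M.closure ((M.E \ {e}) \ A))
    (hcf : ∀ e ∈ M.E, ¬ M.IsColoop e) (hd : M.E.encard = M.eRank + 10) (hn : 37 ≤ M.E.ncard) :
    {C : Set α | M.IsCircuit C ∧ C.ncard = 5}.ncard ≤ 1170 := by
  have h := ncard_fiveCircuits_sub_div_le_avgChain5b_of_coloopFree M hfree hcf (d := 9) (m := 37)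
    (by rw [hd]; norm_num) (by norm_num) hn
  rw [avgChain5b_values_cf.2.2.2.1] at h
  omega

/-- **`s₅ ≤ 1748` on a coloop-free core of nullity `11` with `≥ 38` points** (`s − ⌊5s/38⌋ ≤ 1518`). -/
theorem s5_cf_11 (M : Matroid α) [M.Finite]
    (hfree : ∀ e ∈ M.E, ∃ A ⊆ M.E \ {e}, e ∉ M.closure A ∧ e ∉ M.closure ((M.E \ {e}) \ A))
    (hcf : ∀ e ∈ M.E, ¬ M.IsColoop e) (hd : M.E.encard = M.eRank + 11) (hn : 38 ≤ M.E.ncard) :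
    {C : Set α | M.IsCircuit C ∧ C.ncard = 5}.ncard ≤ 1748 := by
  have h := ncard_fiveCircuits_sub_div_le_avgChain5b_of_coloopFree M hfree hcf (d := 10) (m := 38)
    (by rw [hd]; norm_num) (by norm_num) hn
  rw [avgChain5b_values_cf.2.2.2.2.1] at h
  omega

/-- **`s₅ ≤ 2532` on a coloop-free core of nullity `12` with `≥ 39` points** (`s − ⌊5s/39⌋ ≤ 2208`). -/
theorem s5_cf_12 (M : Matroid α) [M.Finite]
    (hfree : ∀ e ∈ M.E, ∃ A ⊆ M.E \ {e}, e ∉ M.closure A ∧ e ∉ M.closure ((M.E \ {e}) \ A))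
    (hcf : ∀ e ∈ M.E, ¬ M.IsColoop e) (hd : M.E.encard = M.eRank + 12) (hn : 39 ≤ M.E.ncard) :
    {C : Set α | M.IsCircuit C ∧ C.ncard = 5}.ncard ≤ 2532 := by
  have h := ncard_fiveCircuits_sub_div_le_avgChain5b_of_coloopFree M hfree hcf (d := 11) (m := 39)
    (by rw [hd]; norm_num) (by norm_num) hn
  rw [avgChain5b_values_cf.2.2.2.2.2.1] at h
  omega

/-- **`s₅ ≤ 3574` on a coloop-free core of nullity `13` with `≥ 40` points** (`s − ⌊5s/40⌋ ≤ 3128`). -/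
theorem s5_cf_13 (M : Matroid α) [M.Finite]
    (hfree : ∀ e ∈ M.E, ∃ A ⊆ M.E \ {e}, e ∉ M.closure A ∧ e ∉ M.closure ((M.E \ {e}) \ A))
    (hcf : ∀ e ∈ M.E, ¬ M.IsColoop e) (hd : M.E.encard = M.eRank + 13) (hn : 40 ≤ M.E.ncard) :
    {C : Set α | M.IsCircuit C ∧ C.ncard = 5}.ncard ≤ 3574 := by
  have h := ncard_fiveCircuits_sub_div_le_avgChain5b_of_coloopFree M hfree hcf (d := 12) (m := 40)
    (by rw [hd]; norm_num) (by norm_num) hn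
  rw [avgChain5b_values_cf.2.2.2.2.2.2.1] at h
  omega

/-- **`s₅ ≤ 4932` on a coloop-free core of nullity `14` with `≥ 41` points** (`s − ⌊5s/41⌋ ≤ 4331`). -/
theorem s5_cf_14 (M : Matroid α) [M.Finite]
    (hfree : ∀ e ∈ M.E, ∃ A ⊆ M.E \ {e}, e ∉ M.closure A ∧ e ∉ M.closure ((M.E \ {e}) \ A))
    (hcf : ∀ e ∈ M.E, ¬ M.IsColoop e) (hd : M.E.encard = M.eRank + 14) (hn : 41 ≤ M.E.ncard) :
    {C : Set α | M.IsCircuit C ∧ C.ncard = 5}.ncard ≤ 4932 := by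
  have h := ncard_fiveCircuits_sub_div_le_avgChain5b_of_coloopFree M hfree hcf (d := 13) (m := 41)
    (by rw [hd]; norm_num) (by norm_num) hn
  rw [avgChain5b_values_cf.2.2.2.2.2.2.2] at h
  omega

/-- **The level arithmetic with a general denominator**: `level_arith_K` (RankLevelSetLevelSixHeavyCell) with
`Φ ≤ 2^{p+q}/D` and the polynomial inequality against `L·2^{d−q}·D` in place of `C(p+q, q)`. -/
theorem level_arith_KD {p d n q : ℕ} {K L Φ U Y A B N D : ℚ} (hn : n = p + d) (hd : q ≤ d) (hK : 0 < K)
    (hL : L + 1 = K) (hD : 0 < D)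
    (hΦ : Φ ≤ (2 : ℚ) ^ (p + q) / D) (hU0 : 0 ≤ U)
    (hU : U ≤ ((p + d).choose q : ℚ) + N) (hY : (2 : ℚ) ^ n ≤ Y + A + B) (hAB : K * (A + B) ≤ 2 ^ n)
    (hpoly : K * (((p + d).choose q : ℚ) + N) ≤ L * 2 ^ (d - q) * D) : Φ * U ≤ Y := by
  have hpow : (2 : ℚ) ^ n = 2 ^ (p + q) * 2 ^ (d - q) := by
    rw [← pow_add]; congr 1; omega
  have h1 : Φ * U ≤ (2 : ℚ) ^ (p + q) / D * U := mul_le_mul_of_nonneg_right hΦ hU0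
  have h2 : (2 : ℚ) ^ (p + q) / D * U ≤ (2 : ℚ) ^ (p + q) / D * (((p + d).choose q : ℚ) + N) :=
    mul_le_mul_of_nonneg_left hU (by positivity)
  have h3 : K * ((2 : ℚ) ^ (p + q) / D * (((p + d).choose q : ℚ) + N)) ≤ L * 2 ^ n := by
    rw [hpow, div_mul_eq_mul_div, ← mul_div_assoc, div_le_iff₀ hD]
    nlinarith [hpoly, pow_pos (show (0 : ℚ) < 2 by norm_num) (p + q)]
  have h4 : L * 2 ^ n ≤ K * Y := by
    have e1 : K * (2 : ℚ) ^ n ≤ K * Y + K * A + K * B := by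
      have := mul_le_mul_of_nonneg_left hY hK.le
      rw [mul_add, mul_add] at this
      exact this
    have e2 : K * A + K * B ≤ 2 ^ n := by rw [← mul_add]; exact hAB
    have e3 : L * (2 : ℚ) ^ n = K * 2 ^ n - 2 ^ n := by rw [← hL]; ring
    linarith
  have h5 : K * (Φ * U) ≤ K * Y := by
    calc K * (Φ * U) ≤ K * ((2 : ℚ) ^ (p + q) / D * (((p + d).choose q : ℚ) + N)) :=
          mul_le_mul_of_nonneg_left (h1.trans h2) hK.le
      _ ≤ L * 2 ^ n := h3
      _ ≤ K * Y := h4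
  exact le_of_mul_le_mul_left h5 hK

/-- **The coloop split**: for a coloop `e` of `M` with `r(M) = p + 1` and `q + 1 < p`, the scaled inequality
`(Φ(p+1, q+1)/2)·#U_{M∖e}(p, q+1) ≤ #Y_{M∖e}(p, q+1)` gives `RLS M (p+1) (q+1)` (`#U_M = #U_{M∖e}`,
`#Y_M = 2·#Y_{M∖e} + W_p(M∖e) + W_{q+1}(M∖e)`). -/
theorem RLS_of_coloop_scaled (M : Matroid α) [M.Finite] {e : α} (he : M.IsColoop e) {p q : ℕ} (hp : q + 1 < p)
    (hR : M.eRank = ((p + 1 : ℕ) : ℕ∞))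
    (h : phiK (p + 1) (q + 1) / 2 * (Matroid.topCount (M ＼ {e}) p (q + 1) : ℚ) ≤
      (Matroid.midCount (M ＼ {e}) p (q + 1) : ℚ)) :
    RLS M (p + 1) (q + 1) := by
  rw [RLS_iff, Matroid.topCount_eq_of_isColoop_of_eRank he q hR, Matroid.midCount_eq_of_isColoop_q he hp]
  push_cast
  have h1 : (0 : ℚ) ≤ (Matroid.levelCount (M ＼ {e}) p : ℚ) := Nat.cast_nonneg _
  have h2 : (0 : ℚ) ≤ (Matroid.levelCount (M ＼ {e}) (q + 1) : ℚ) := Nat.cast_nonneg _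
  linarith

/-- The scaled weight of the coloop split is below the general-denominator bound: `Φ(p+1, q+1)/2 ≤ 2^{p+q}/C(p+q+1, q)`
(from `phiK_le_two_pow_div (p + 1) q`). -/
theorem phiK_succ_div_two_le (p q : ℕ) :
    phiK (p + 1) q / 2 ≤ (2 : ℚ) ^ (p + q) / (((p + 1 + q).choose q : ℕ) : ℚ) := by
  have h := phiK_le_two_pow_div (p + 1) q
  rw [Nat.choose_symm_add] at h
  have hc : (0 : ℚ) < (((p + 1 + q).choose q : ℕ) : ℚ) := by exact_mod_cast Nat.choose_pos (by omega)
  rw [div_le_div_iff₀ (by norm_num) hc]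
  rw [le_div_iff₀ hc] at h
  have : (2 : ℚ) ^ (p + 1 + q) = 2 ^ (p + q) * 2 := by rw [← pow_succ]; congr 1; omega
  nlinarith [h, hc]

end ThmN

end PercRepro
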